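import Summits.ResolutionOfSingularities.ResolutionOfSingularities.Theses.RuledResidues
import Literature.AlgebraicGeometry.Resolution.QuadraticSequenceDimOneExistence
import Literature.AlgebraicGeometry.Resolution.QuadraticTransformsProofs
import Literature.AlgebraicGeometry.Resolution.QuadraticTransformsUFD
import Literature.AlgebraicGeometry.Resolution.DivisorialPlace
import HarnessLib

/-!
# `RuledResidues.RegularModelRuled` (stmt-ResolutionOfSingularities-18077), part 1/3 — DVR reach and the penultimate ring

Route `ResolutionOfSingularities/RuledResidues`, crux `RegularModelRuled` (Abhyankar's ruledness of
the residue field of a divisorial place dominating a regular local ring of dimension `≥ 2`), line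
`dvr-descent` (`Cruxes/RegularModelRuled/Lines/dvr_descent.lean`). This file: the quadratic
sequence `R₀ → R₁ → ⋯` of a local ring of `K` ALONG a DISCRETE valuation ring `O` has `O = ⋃ Rᵢ`
(Abhyankar's descent `exists_descent_sequence` + discreteness — no dimension hypothesis; the tree's
`QuadraticSequenceDimOne` needed Krull–Akizuki for this in dimension one), hence REACHES `O` when
`O` is essentially of finite type over `R₀` (`dvrReach`); if `R₀` is regular of dimension `≥ 2`
the member before `O` is regular of dimension `≥ 2` with transform `O` (`penultimate`); and the
regular sequence exists at every step (`isQuadraticTransformAlong_quadraticSeq_of_isRegularLocalRing`).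
Parts 2/3: `RuledResiduesRegularModelRuledExceptional.lean` (residue field of the exceptional
prime), `RuledResiduesRegularModelRuled.lean` (field plumbing and the crux).

References: Abhyankar 1956, *On the valuations centered in a local domain*, Prop. 3;
Zariski–Samuel II, App. 5.
-/

-- single-problem summit: the doubled namespace component `ResolutionOfSingularities` is forced
set_option linter.dupNamespace false

namespace Summit.ResolutionOfSingularities.ResolutionOfSingularities.Theorems.RuledResiduesRegularModelRuled

open IsLocalRing Literature.AlgebraicGeometry.Resolution IsDiscreteValuationRing

noncomputable section

/-! ## DVR reach (Abhyankar's descent + discreteness; no dimension hypothesis) -/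

/-- In a discrete valuation ring `O ⊆ K` there is no sequence of nonzero elements of `O` whose
values strictly increase (towards `1`): the additive valuations would strictly decrease in `ℕ`. -/
theorem not_strictMono_valuation_of_isDiscreteValuationRing {K : Type} [Field K]
    (O : ValuationSubring K) [IsDiscreteValuationRing O] (y : ℕ → K) (hyO : ∀ i, y i ∈ O)
    (hy0 : ∀ i, y i ≠ 0) (hmono : ∀ i, O.valuation (y i) < O.valuation (y (i + 1))) : False := by
  classical
  set a : ℕ → O := fun i => ⟨y i, hyO i⟩ with ha
  have ha0 : ∀ i, a i ≠ 0 := fun i h => hy0 i (congrArg Subtype.val h)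
  have hfin : ∀ i, addVal O (a i) ≠ ⊤ := fun i h => ha0 i (addVal_eq_top_iff.mp h)
  -- one step: `a i = b * a (i+1)` with `b` a non-unit, so the additive valuation drops by `≥ 1`
  have hstep : ∀ i, addVal O (a (i + 1)) + 1 ≤ addVal O (a i) := by
    intro i
    obtain ⟨b, hb⟩ := (O.valuation_le_iff (y i) (y (i + 1))).mp (hmono i).le
    have hab : a i = b * a (i + 1) := Subtype.ext (by simpa [ha] using hb.symm)
    have hbu : ¬ IsUnit b := by
      intro hu
      have hvb : O.valuation (b : K) = 1 := (O.valuation_eq_one_iff b).mp hu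
      have : O.valuation (y i) = O.valuation (y (i + 1)) := by
        rw [← hb, map_mul, hvb, one_mul]
      exact (hmono i).ne this
    have hb1 : 1 ≤ addVal O b :=
      Order.one_le_iff_ne_zero.mpr fun h => hbu (addVal_eq_zero_iff.mp h)
    rw [hab, addVal_mul, add_comm (addVal O b)]
    exact add_le_add_right hb1 _
  have key : ∀ i : ℕ, addVal O (a i) + i ≤ addVal O (a 0) := by
    intro i
    induction i with
    | zero => simp
    | succ i ih =>
      calc addVal O (a (i + 1)) + ((i + 1 : ℕ) : ℕ∞)
          = (addVal O (a (i + 1)) + 1) + i := by push_cast; ring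
        _ ≤ addVal O (a i) + i := add_le_add_left (hstep i) _
        _ ≤ addVal O (a 0) := ih
  obtain ⟨m, hm⟩ := ENat.ne_top_iff_exists.mp (hfin 0)
  have h1 := key (m + 1)
  rw [← hm] at h1
  have h2 : ((m + 1 : ℕ) : ℕ∞) ≤ (m : ℕ∞) := le_trans le_add_self h1
  have h3 : m + 1 ≤ m := by exact_mod_cast h2
  omega

section DvrReach

variable {K : Type} [Field K] {O : ValuationSubring K} {A : ℕ → Subring K}

/-- **`O = ⋃ Aᵢ` for the quadratic sequence of a local ring of `K` along a DISCRETE valuation ring**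
(Abhyankar's descent, no dimension hypothesis). -/
theorem mem_sequence_of_mem_of_isDiscreteValuationRing [IsDiscreteValuationRing O]
    (hof : IsLocalRingOf (A 0)) (h0 : SubringDominates (A 0) O.toSubring)
    (hstep : ∀ i, IsQuadraticTransformAlong O (A i) (A (i + 1))) {t : K} (ht : t ∈ O) :
    ∃ i, t ∈ A i := by
  classical
  by_contra hcon
  rw [not_exists] at hcon
  have ht' : ∀ i, t⁻¹ ∉ A i := fun i hti => hcon i (mem_sequence_of_inv_mem h0 hstep ht hti)
  have hdomO : ∀ i, SubringDominates (A i) O.toSubring := fun i => (sequence_dominates h0 hstep i).1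
  obtain ⟨y₀, hy₀, z₀, hz₀, -, htyz⟩ := hof.2 t
  obtain ⟨y, x, hy0, hyR, hx, hysucc⟩ := exists_descent_sequence hstep hcon ht' hy₀ hz₀ htyz
  have ht0 : t ≠ 0 := fun h => hcon 0 (h ▸ (A 0).zero_mem)
  have hy_ne : ∀ i, y i ≠ 0 := by
    intro i
    induction i with
    | zero =>
      rw [hy0]
      rintro rfl
      rw [zero_div] at htyz
      exact ht0 htyz
    | succ i ih => rw [hysucc]; exact div_ne_zero ih (hx i).2.1
  have hmono : ∀ i, O.valuation (y i) < O.valuation (y (i + 1)) := by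
    intro i
    obtain ⟨hxi, hxi0, hxiinv⟩ := hx i
    have hvx : O.valuation (x i) < 1 := valuation_lt_one_of_subringDominates (hdomO i) hxi hxiinv
    have hvx0 : O.valuation (x i) ≠ 0 := (_root_.map_ne_zero _).mpr hxi0
    have hvy0 : O.valuation (y i) ≠ 0 := (_root_.map_ne_zero _).mpr (hy_ne i)
    rw [hysucc, map_div₀, lt_div_iff₀ (pos_iff_ne_zero.mpr hvx0)]
    have := mul_lt_mul_of_lt_of_le_of_nonneg_of_pos hvx (le_refl (O.valuation (y i))) zero_le
      (pos_iff_ne_zero.mpr hvy0)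
    rwa [one_mul, mul_comm] at this
  exact not_strictMono_valuation_of_isDiscreteValuationRing O y
    (fun i => (hdomO i).1 (hyR i)) hy_ne hmono

/-- A finite subset of the DVR `O` lies in some member of the sequence. -/
theorem exists_finset_subset_sequence_of_isDiscreteValuationRing [IsDiscreteValuationRing O]
    (hof : IsLocalRingOf (A 0)) (h0 : SubringDominates (A 0) O.toSubring)
    (hstep : ∀ i, IsQuadraticTransformAlong O (A i) (A (i + 1))) (S : Finset K)
    (hS : (S : Set K) ⊆ O) : ∃ c, (S : Set K) ⊆ A c := by
  classical
  have hmono : Monotone A := sequence_monotone hstep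
  induction S using Finset.induction_on with
  | empty => exact ⟨0, by simp⟩
  | insert a S haS ih =>
    rw [Finset.coe_insert] at hS
    obtain ⟨c₁, hc₁⟩ := ih ((Set.subset_insert _ _).trans hS)
    obtain ⟨c₂, hc₂⟩ := mem_sequence_of_mem_of_isDiscreteValuationRing hof h0 hstep
      (hS (Set.mem_insert _ _))
    refine ⟨max c₁ c₂, ?_⟩
    rw [Finset.coe_insert, Set.insert_subset_iff]
    exact ⟨hmono (le_max_right _ _) hc₂, hc₁.trans (hmono (le_max_left _ _))⟩

end DvrReach

/-- **DVR reach** (was `stub_dvrReach`): the quadratic sequence of a local ring of `K` along a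
discrete valuation ring `O` essentially of finite type over it reaches `O`. -/
theorem dvrReach {K : Type} [Field K] (O : ValuationSubring K) [IsDiscreteValuationRing O]
    (R : ℕ → Subring K) (hof : IsLocalRingOf (R 0)) (h0 : SubringDominates (R 0) O.toSubring)
    (hstep : ∀ i, IsQuadraticTransformAlong O (R i) (R (i + 1)))
    {N : Subring K} (hNO : N ≤ O.toSubring) (S : Finset K) (hSN : (S : Set K) ⊆ N)
    (hNS : N ≤ Subring.closure ((R 0 : Set K) ∪ ↑S))
    (hON : O.toSubring ≤ locAtCentre N O) :
    ∃ c, R c = O.toSubring := by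
  classical
  have hSO : (S : Set K) ⊆ O := fun s hs => hNO (hSN hs)
  obtain ⟨c, hc⟩ := exists_finset_subset_sequence_of_isDiscreteValuationRing hof h0 hstep S hSO
  have hmono : Monotone R := sequence_monotone hstep
  have hNA : N ≤ R c := by
    refine hNS.trans (Subring.closure_le.mpr ?_)
    rintro z (hz | hz)
    · exact hmono (Nat.zero_le c) hz
    · exact hc hz
  have hdom : SubringDominates (R c) O.toSubring := (sequence_dominates h0 hstep c).1
  refine ⟨c, le_antisymm hdom.1 ?_⟩
  intro z hz
  obtain ⟨y, hy, w, hw, hvw, rfl⟩ := (mem_locAtCentre_iff).mp (hON hz)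
  have hwinv : w⁻¹ ∈ O := by
    rw [← O.valuation_le_one_iff, map_inv₀, hvw, inv_one]
  have hwinvA : w⁻¹ ∈ R c := hdom.2 w (hNA hw) hwinv
  rw [div_eq_mul_inv]
  exact (R c).mul_mem (hNA hy) hwinvA

/-! ## Proved: the penultimate ring -/

section Penultimate

variable {K : Type} [Field K]

/-- A regular local subring of `K` of dimension `≤ 1` with fraction field `K`, dominated by the
valuation ring `O`, is `O` (it is a valuation ring of `K` — a field or a DVR — dominated by `O`). -/
theorem eq_of_isRegularLocalRing_of_ringKrullDim_le_one {O : ValuationSubring K} {S : Subring K}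
    (hreg : IsRegularLocalRing S) (hdim : ringKrullDim S ≤ 1)
    (hof : ∀ z : K, ∃ a ∈ S, ∃ b ∈ S, b ≠ 0 ∧ z = a / b) (hdom : SubringDominates S O.toSubring) :
    S = O.toSubring := by
  haveI : IsPrincipalIdealRing S := isPrincipalIdealRing_of_ringKrullDim_le_one hdim
  haveI : ValuationRing S :=
    (ValuationRing.iff_local_bezout_domain (R := S)).mpr ⟨inferInstance, inferInstance⟩
  haveI : IsFractionRing S K := isFractionRing_of_isLocalRingOf_le hof le_rfl
  refine le_antisymm hdom.1 fun z hz => ?_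
  rcases ValuationRing.isInteger_or_isInteger S z with ⟨a, ha⟩ | ⟨a, ha⟩
  · rw [← ha]; exact a.2
  · have hinv : z⁻¹ ∈ S := by rw [← ha]; exact a.2
    have h := hdom.2 z⁻¹ hinv (by rw [inv_inv]; exact hz)
    rwa [inv_inv] at h

/-- For a regular local ring, `¬ (dim ≤ 1)` means `2 ≤ dim` (the dimension is a natural number). -/
theorem two_le_ringKrullDim_of_not_le_one {S : Type} [CommRing S] [IsRegularLocalRing S]
    (h : ¬ ringKrullDim S ≤ 1) : (2 : WithBot ℕ∞) ≤ ringKrullDim S := by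
  have h1 := (isRegularLocalRing_iff S).mp ‹_›
  rw [← h1] at h ⊢
  have h2 : ¬ (maximalIdeal S).spanFinrank ≤ 1 := fun h' => h (by exact_mod_cast h')
  have h3 : 2 ≤ (maximalIdeal S).spanFinrank := by omega
  exact_mod_cast h3

/-- **The penultimate ring** (was `stub_penultimate`, PROVED): if the sequence from a regular `R₀`
of dimension `≥ 2` reaches the DVR `O`, some `R_n` is regular of dimension `≥ 2` with `R_{n+1} = O`. -/
theorem penultimate (O : ValuationSubring K) [IsDiscreteValuationRing O]
    (R : ℕ → Subring K) (hreg : IsRegularLocalRing (R 0))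
    (hdim : (2 : WithBot ℕ∞) ≤ ringKrullDim (R 0)) (hof : IsLocalRingOf (R 0))
    (h0 : SubringDominates (R 0) O.toSubring)
    (hstep : ∀ i, IsQuadraticTransformAlong O (R i) (R (i + 1))) (hc : ∃ c, R c = O.toSubring) :
    ∃ n, IsRegularLocalRing (R n) ∧ (2 : WithBot ℕ∞) ≤ ringKrullDim (R n) ∧
      R (n + 1) = O.toSubring := by
  classical
  have hregi : ∀ i, IsRegularLocalRing (R i) := isRegularLocalRing_sequence hreg hstep
  have hdomO : ∀ i, SubringDominates (R i) O.toSubring := fun i => (sequence_dominates h0 hstep i).1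
  have hmono : Monotone R := sequence_monotone hstep
  -- a member equal to `O` has dimension `1`
  have hdim_of_eq : ∀ i, R i = O.toSubring → ringKrullDim (R i) = 1 := by
    intro i hi
    rw [ringKrullDim_eq_of_ringEquiv (RingEquiv.subringCongr hi)]
    exact IsDiscreteValuationRing.ringKrullDim_eq_one O
  -- minimal index with `R m = O`; it is positive
  have hRm : R (Nat.find hc) = O.toSubring := Nat.find_spec hc
  have hm0 : Nat.find hc ≠ 0 := by
    intro h0m
    have h1 := hdim_of_eq 0 (by rw [← h0m]; exact hRm)
    rw [h1] at hdim
    exact absurd hdim (by decide)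
  obtain ⟨n, hn⟩ := Nat.exists_eq_succ_of_ne_zero hm0
  have hRn : R n ≠ O.toSubring := Nat.find_min hc (by rw [hn]; exact Nat.lt_succ_self n)
  rw [hn] at hRm
  refine ⟨n, hregi n, ?_, hRm⟩
  -- `R n` is not of dimension `≤ 1`: it would be a valuation ring of `K` dominated by `O`, i.e. `O`
  haveI := hregi n
  refine two_le_ringKrullDim_of_not_le_one fun hle => hRn ?_
  have hofn : ∀ z : K, ∃ a ∈ R n, ∃ b ∈ R n, b ≠ 0 ∧ z = a / b := fun z => by
    obtain ⟨a, ha, b, hb, hb0, rfl⟩ := hof.2 z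
    exact ⟨a, hmono (Nat.zero_le n) ha, b, hmono (Nat.zero_le n) hb, hb0, rfl⟩
  exact eq_of_isRegularLocalRing_of_ringKrullDim_le_one (hregi n) hle hofn (hdomO n)

end Penultimate

/-! ## Proved glue: the regular quadratic sequence exists at every step -/

/-- The sequence `quadraticSeq O A` of a regular local ring `A ⊆ O` of `K`, not a field and
dominated by `O`, is an infinite sequence of quadratic transforms along `O` (each member is
regular, hence Noetherian, and not a field, so the next transform exists). -/
theorem isQuadraticTransformAlong_quadraticSeq_of_isRegularLocalRing {K : Type} [Field K]
    {O : ValuationSubring K} {A : Subring K} (hreg : IsRegularLocalRing A) (hA : ¬ IsField A)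
    (h0 : SubringDominates A O.toSubring) (n : ℕ) :
    IsQuadraticTransformAlong O (quadraticSeq O A n) (quadraticSeq O A (n + 1)) := by
  -- invariant: `A_n` is regular local, contains `A`, and is dominated by `O`
  have inv : ∀ n, ∃ _ : IsRegularLocalRing (quadraticSeq O A n), A ≤ quadraticSeq O A n ∧
      SubringDominates (quadraticSeq O A n) O.toSubring ∧
      IsQuadraticTransformAlong O (quadraticSeq O A n) (quadraticSeq O A (n + 1)) := by
    intro n
    induction n with
    | zero =>
      haveI : IsRegularLocalRing (quadraticSeq O A 0) := hreg
      refine ⟨‹_›, le_rfl, h0, ?_⟩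
      exact quadraticSeq_succ_of_exists (exists_isQuadraticTransformAlong h0.1
        (maximalIdeal_ne_bot_of_subringDominates (B := quadraticSeq O A 0) hA h0 le_rfl h0.1))
    | succ n ih =>
      obtain ⟨_, hAn, hdomn, hstepn⟩ := ih
      haveI : IsRegularLocalRing (quadraticSeq O A (n + 1)) :=
        hstepn.isRegularLocalRing_of_isRegularLocalRing ‹_›
      haveI : IsLocalRing A := hreg.toIsLocalRing
      have hA1 : A ≤ quadraticSeq O A (n + 1) := hAn.trans hstepn.le
      have hdom1 : SubringDominates (quadraticSeq O A (n + 1)) O.toSubring := hstepn.dominated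
      refine ⟨‹_›, hA1, hdom1, ?_⟩
      exact quadraticSeq_succ_of_exists (exists_isQuadraticTransformAlong hdom1.1
        (maximalIdeal_ne_bot_of_subringDominates hA h0 hA1 hdom1.1))
  exact (inv n).2.2.2

end

end Summit.ResolutionOfSingularities.ResolutionOfSingularities.Theorems.RuledResiduesRegularModelRuled
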